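import Summits.BirchSwinnertonDyer.BirchSwinnertonDyer.Theorems.GenusKolyvaginAtTwoPowDvdShaCardAtTwoRTKolyvaginSuppliesOfSockets
import Summits.BirchSwinnertonDyer.BirchSwinnertonDyer.Theorems.GenusKolyvaginAtTwoMinimalTwinBSDTwoBridges
import Summits.BirchSwinnertonDyer.BirchSwinnertonDyer.Theorems.GenusKolyvaginAtTwoPubInputsAtTwoDefs
import HarnessLib

/-!
# Route `GenusKolyvaginAtTwo`, crux L_T `PowDvdShaCardAtTwoRT` (stmt-BirchSwinnertonDyer-23299, ex 23242), LINE 18 `plus_descent`: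
# STUB KS IN GROSS-WITNESS CURRENCY — closed BY NAME from the landed sockets (W-UP-free form)

LEAD seat `bsd-line-gk2-p1` g18 (cell `bsd-f1-sign2`), `--supports 23299 --as helper`.  ONE THEOREM, a composition; no `sorry`; standard axioms.
BSD is NOT proved by this; neither is the crux.

WHAT.  `kolyvaginSystemAtTwo_of_grossWitness_direct` is the registered text of stub KS `stub_kolyvaginSystemAtTwo` of skeleton v5.4
(`Cruxes/PowDvdShaCardAtTwoRT/Lines/plus_descent.lean` @647dfb56da73) VERBATIM — i.e. the v5.3 KS text with its witness binders `n d hn hKoly hPn` in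
GROSS currency `Zhang2014.IsKolyvaginPrime … ℓ ∧ 2 ≤ Zhang2014.kolyvaginIndex W 2 ℓ ∧ FrobEqFrobInfty W K 2 ℓ` (the skeleton-local antecedent
`CyclicFixedPartOfNegDisc` spelled out by its defining text, so the skeleton closes the stub by `exact`).  That witness clause is BYTE-IDENTICAL to the
`hKoly` clause of the route pen's option (β″) (crux-dir kit `Lines/plus_descent_restate35_kit.lean`, gk2-p5 g25, def `PowDvdShaCardAtTwoRT35`; LEAD ruling
R4, STATUS 18:10Z): under (β″) this theorem IS stub KS of the line with no W-UP in between; under the current rev it is stub KS fed by stub W-UP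
`stub_grossWitnessAtTwo` (v5.4 wiring), and gk2-p3 g24's `kolyvaginSystemAtTwo_of_grossWitnessAtTwo` (p736486) is the v5.3 wiring of the same content.

PROOF.  gk2-p3 g24's by-name sockets composition `PlusDescent.kolyvaginSuppliesAtTwo_of_grossWitness_onHabitat` (p735895) — over LEAD
`PlusDescent.deepSwap_socket` (p734487: the EXACT McCallum prime swap at 2, local laws discharged by gk2-p3 g23), gk2-p3
`TransverseValue.hbot_socket_margin_onHabitat_of_three_le` (bottom rung, (V44)-socket discharged p731565), gk2-p5 `RelaxedCount.hK_socket_margin`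
(p727553) and gk2-p2 `kolyvaginSuppliesAtTwo_of_deepSwap` (p727242) — at level `L := 2M₀ + 12`, margin `k := 1`; the big-image binder moved to the
`ℕ`-currency by `MinimalTwinBSDTwo.forall_hasSurjectiveModNGaloisRep_two_pow_of_pos`.  KS's own (NPh) binder and the antecedents `PubInputsAtTwo`,
Q5R, Q1-cyclic, `¬ IsOfFinAddOrder`, the twin `Wd` and its budget binder are carried but unused (the (D-NPh) place discharges (NPh) inside p735895).
Namespace `…Theorems.GenusExact.PlusDescent`.  Closes nothing by itself.

References: [McCallumLMS1991] §5 Prop. 5.2, Lemma 5.3, Thm. 5.4; [GrossLMS1991] §3 (3.3), Prop. 3.7; [Kolyvagin1991StructureSha].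
-/

set_option autoImplicit false
-- the Theorems namespace of this sub repeats the summit name by design (D-0017 nested layout)
set_option linter.dupNamespace false

noncomputable section

open scoped Classical
open WeierstrassCurve NumberField IsDedekindDomain Field
open Literature.NumberTheory.GaloisRepresentations Literature.NumberTheory.EllipticCurves
open Literature.NumberTheory
open Summit.BirchSwinnertonDyer.BirchSwinnertonDyer.Theses.GenusKolyvaginAtTwo

namespace Summit.BirchSwinnertonDyer.BirchSwinnertonDyer.Theorems.GenusExact.PlusDescent

/-- **Stub KS of LINE 18 in Gross-witness currency (skeleton v5.4 text verbatim; = stub KS under the pen's option (β″)).**  On L_T's frame with the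
(D-NPh) multiplicative place, from a square-free product `n` of level-2 GROSS–Kolyvagin primes (Zhang ∧ index ≥ 2 ∧ `Frob = Frob_∞` on `K(E[2])`) carrying a
datum with `P(n) ∉ 2E(K[n])`: for the non-trivial `τ ∈ Gal(K/ℚ)` a level `L > M₀`, antitone minima `Mr` with `Mr 0 = M₀`, `Mr R = 0`, and McCallum's
Prop. 5.2 supplies at every drop, with avoidance — gk2-p3 g24's sockets composition at `L = 2M₀ + 12`, `k = 1`.
[cite: McCallumLMS1991, §5 Prop. 5.2, Thm. 5.4] [cite: GrossLMS1991, §3 (3.3), Prop. 3.7] -/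
theorem kolyvaginSystemAtTwo_of_grossWitness_direct :
    PubInputsAtTwo → KolyvaginRelationAtTwo → EquivariantChebotarevAtTwoR → (∀ (W : WeierstrassCurve ℚ) [W.IsElliptic], W.Δ < 0 → ∀ (c₀ : Field.absoluteGaloisGroup ℚ), Literature.NumberTheory.GaloisRepresentations.IsComplexConjugation (Rat.castHom ℝ) c₀ → ∀ (M : ℕ), ∃ P : W.geomTorsion ((2 ^ M : ℕ) : ℤ), addOrderOf P = 2 ^ M ∧ ∀ Q : W.geomTorsion ((2 ^ M : ℕ) : ℤ), c₀ • Q = Q ↔ Q ∈ AddSubgroup.zmultiples P) → ∀ (W : WeierstrassCurve ℚ) [W.IsElliptic] [W.IsGloballyMinimal] [NeZero (W.conductorNorm ℤ)], ¬ W.HasCM → Odd W.tamagawaProduct → ∀ (v : IsDedekindDomain.HeightOneSpectrum (NumberField.RingOfIntegers ℚ)), ((2 : ℕ) : NumberField.RingOfIntegers ℚ) ∉ v.asIdeal → ((W.conductorNorm ℤ : ℕ) : NumberField.RingOfIntegers ℚ) ∈ v.asIdeal → W.HasMultiplicativeReductionAt v → W.Δ < 0 → ∀ (K : Type) [Field K]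 [NumberField K], Literature.NumberTheory.EllipticCurves.IsImaginaryQuadratic K → Odd (NumberField.discr K) → NumberField.discr K ≠ -3 → Literature.NumberTheory.EllipticCurves.SatisfiesHeegnerHypothesis (W.conductorNorm ℤ) K → ¬ IsSquare ((NumberField.discr K : ℚ) * -|W.Δ|) → ¬ IsSquare ((NumberField.discr K : ℚ) * (-(2 * |W.Δ|))) → (∀ n : ℕ, 0 < n → W.HasSurjectiveModNGaloisRep ((2 : ℤ) ^ n)) → ∀ (Dt : Literature.NumberTheory.EllipticCurves.ModularForms.ModularParametrizationData W (W.conductorNorm ℤ)) (β : ℤ) (ι : K →+* ℂ) (d₁ : Literature.NumberTheory.EllipticCurves.KolyvaginHeegnerData Dt β ι 1), ¬ IsOfFinAddOrder d₁.derivedPoint → ∀ (M₀ : ℕ), (∃ Q : (W.baseChange (Literature.NumberTheory.EllipticCurves.ringClassField K ι 1)).toAffine.Point, ((2 ^ M₀ : ℕ) : ℤ) • Q = d₁.derivedPoint) → (¬ ∃ Q : (W.baseChange (Literature.NumberTheory.EllipticCurves.ringClassField K ι 1)).toAffine.Point, ((2 ^ (M₀ + 1) : ℕ) : ℤ) • Q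 = d₁.derivedPoint) → ∀ (n : ℕ) (d : Literature.NumberTheory.EllipticCurves.KolyvaginHeegnerData Dt β ι n), Squarefree n → (∀ ℓ ∈ n.primeFactors, Literature.NumberTheory.EllipticCurves.Zhang2014.IsKolyvaginPrime (W.conductorNorm ℤ) W K 2 ℓ ∧ 2 ≤ Literature.NumberTheory.EllipticCurves.Zhang2014.kolyvaginIndex W 2 ℓ ∧ Literature.NumberTheory.EllipticCurves.FrobEqFrobInfty W K 2 ℓ) → (¬ ∃ Q : (W.baseChange (Literature.NumberTheory.EllipticCurves.ringClassField K ι n)).toAffine.Point, (2 : ℤ) • Q = d.derivedPoint) → ∀ (Wd : WeierstrassCurve ℚ) [Wd.IsElliptic] [Wd.IsGloballyMinimal], (∃ C : WeierstrassCurve.VariableChange ℚ, C • W.quadraticTwist (NumberField.discr K : ℚ) = Wd) → padicValNat 2 Wd.tamagawaProduct ≤ 1 → (∀ (Mlev : ℕ), 1 ≤ Mlev → ∀ z : galH1Torsion (W.baseChange K) ((2 ^ Mlev : ℕ) : ℤ), (∀ ρ ∈ torsionFixing (W.baseChange K) ((2 ^ Mlev : ℕ) : ℤ), h1Eval (W.baseChange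 K) ((2 ^ Mlev : ℕ) : ℤ) z ρ = 0) → (∀ w : IsDedekindDomain.HeightOneSpectrum (NumberField.RingOfIntegers K), ((2 * W.conductorNorm ℤ : ℕ) : NumberField.RingOfIntegers K) ∈ w.asIdeal → z ∈ selmerLocalKer (W.baseChange K) (w.adicCompletion K) ((2 ^ Mlev : ℕ) : ℤ)) → z = 0) → ∀ τ : K ≃ₐ[ℚ] K, τ ≠ 1 → ∃ (L R : ℕ) (Mr : ℕ → ℕ), M₀ + 1 ≤ L ∧ (∀ j, Mr (j + 1) ≤ Mr j) ∧ Mr 0 = M₀ ∧ Mr R = 0 ∧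
      (∀ m : ℕ, Mr (2 * m + 1) < Mr (2 * m) →
        ∀ (i : ℕ) (u : Fin i → galH1Torsion (W.baseChange K) ((2 ^ L : ℕ) : ℤ)), i ≤ 2 * m + 1 →
        (∀ j, u j ∈ selmerGroup (W.baseChange K) ((2 ^ L : ℕ) : ℤ) ∧
          conjAct W τ ((2 ^ L : ℕ) : ℤ) (u j) = W.rootNumber • u j) →
        ∃ (n : ℕ) (_ : Squarefree n)
          (_ : ∀ ℓ ∈ n.primeFactors, Zhang2014.IsKolyvaginPrime (W.conductorNorm ℤ) W K 2 ℓ ∧ L ≤ Zhang2014.kolyvaginIndex W 2 ℓ)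
          (d : KolyvaginHeegnerData Dt β ι n),
          (∀ ℓ ∈ n.primeFactors, ∀ e : KolyvaginHeegnerData Dt β ι (n / ℓ),
            ((2 ^ (L - Mr (2 * m)) : ℕ) : ℤ) • e.kolyvaginClass Nat.prime_two L = 0) ∧
          addOrderOf (d.kolyvaginClass Nat.prime_two L) = 2 ^ (L - Mr (2 * m + 1)) ∧
          -W.rootNumber * (-1) ^ n.primeFactors.card = W.rootNumber ∧
          Disjoint (AddSubgroup.zmultiples (((2 ^ (L - Mr (2 * m)) : ℕ) : ℤ) • d.kolyvaginClass Nat.prime_two L))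
            (AddSubgroup.closure (Set.range u))) ∧
      (∀ m : ℕ, Mr (2 * m + 2) < Mr (2 * m + 1) →
        ∀ (i : ℕ) (u : Fin i → galH1Torsion (W.baseChange K) ((2 ^ L : ℕ) : ℤ)), i ≤ 2 * m + 1 →
        (∀ j, u j ∈ selmerGroup (W.baseChange K) ((2 ^ L : ℕ) : ℤ) ∧
          conjAct W τ ((2 ^ L : ℕ) : ℤ) (u j) = (-W.rootNumber) • u j) →
        ∃ (n : ℕ) (_ : Squarefree n)
          (_ : ∀ ℓ ∈ n.primeFactors, Zhang2014.IsKolyvaginPrime (W.conductorNorm ℤ) W K 2 ℓ ∧ L ≤ Zhang2014.kolyvaginIndex W 2 ℓ)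
          (d : KolyvaginHeegnerData Dt β ι n),
          (∀ ℓ ∈ n.primeFactors, ∀ e : KolyvaginHeegnerData Dt β ι (n / ℓ),
            ((2 ^ (L - Mr (2 * m + 1)) : ℕ) : ℤ) • e.kolyvaginClass Nat.prime_two L = 0) ∧
          addOrderOf (d.kolyvaginClass Nat.prime_two L) = 2 ^ (L - Mr (2 * m + 2)) ∧
          -W.rootNumber * (-1) ^ n.primeFactors.card = -W.rootNumber ∧
          Disjoint (AddSubgroup.zmultiples (((2 ^ (L - Mr (2 * m + 1)) : ℕ) : ℤ) • d.kolyvaginClass Nat.prime_two L))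
            (AddSubgroup.closure (Set.range u) ⊔ AddSubgroup.zmultiples (d₁.kolyvaginClass Nat.prime_two L))) := by
  intro _hP hQ2 _hQ5R _hCF W _ _ _ hcm hT v h2v hNv hmult hneg K _ _ hIQ hodd h3 hHe hsq1 hsq2 hρ Dt β ι d₁ _hy M₀ hdiv hndiv n₀ e₀ hn₀ hG₀ he₀
    Wd _ _ _hTw _hB _hNPh τ hτ
  obtain ⟨R, Mr, hanti, hM0, hMR, hplus, hminus⟩ :=
    kolyvaginSuppliesAtTwo_of_grossWitness_onHabitat W hQ2 hcm hneg hT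
      (MinimalTwinBSDTwo.forall_hasSurjectiveModNGaloisRep_two_pow_of_pos W hρ) hIQ hodd h3 hHe hsq1 hsq2 h2v hNv hmult τ hτ Dt β ι d₁
      M₀ hdiv hndiv (L := 2 * M₀ + 12) (k := 1) le_rfl le_rfl hn₀ hG₀ e₀ he₀
  exact ⟨2 * M₀ + 12, R, Mr, by omega, hanti, hM0, hMR, hplus, hminus⟩

end Summit.BirchSwinnertonDyer.BirchSwinnertonDyer.Theorems.GenusExact.PlusDescent

end
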